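import Summits.ValiantsHypothesis.ValiantsHypothesis.Theorems.FreeSubtorusOrbitDimensionBoundStubJordanHolderAdaptedBasis

/-!
# `OrbitDimensionBound` (stmt-ValiantsHypothesis-16133), rung line `filtered_covering` — stub `stub_jordanHolder`,
# part 2: weight truncation along filtered gauge; local confluence of one-parameter degenerations

Second helper file for the registered stub `stub_jordanHolder` of `Cruxes/OrbitDimensionBound/Lines/filtered_covering.lean`
(route `FreeSubtorus`, dormant rung `Depth.FilteredShadow`).  Notation (the workfile's `weightTruncate a b X`, unfolded):
`trunc_{a,b} X = Matrix.of fun i j => if a i = b j then X i j else 0`; "`X` block-lower-triangular for `(a, b)`" means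
`a i < b j → X i j = 0` (the gauge form maps the `b`-weight column flag into the `a`-weight row flag).

* §1 `lowerTri_mul`, `truncate_mul` — truncation is MULTIPLICATIVE along filtered products (associated graded of a
  composite of filtered maps); `lowerTri_truncate`, `truncate_truncate_comm`, `truncate_map`, `lowerTri_map`;
* §2 `exists_GL_truncate` — the weight-diagonal part of a filtered invertible matrix (with filtered inverse) is
  invertible (the associated graded of a filtered isomorphism);
* §3 `sum_eq_of_card_filter_eq` — equal level counts give equal total weight (layer cake);
* §4 **`exists_common_degeneration`** — LOCAL CONFLUENCE: two one-parameter degenerations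
  `N₁ = trunc_{a₁,b₁}(g₁ M h₁)`, `N₂ = trunc_{a₂,b₂}(g₂ M h₂)` (`Σ aₖ = Σ bₖ`) of the same square matrix of polynomials
  `M` have a COMMON one-parameter degeneration `E` (in the workfile's unfolded `IsDegeneration ⊤` format): common adapted
  bases for the two row flags and for the two column flags (part 1, `exists_common_gauge`) give a gauge form
  `X = P⋆ M Q⋆` block-lower-triangular for both transported weight pairs, the transported truncations are constant
  gauge forms of `N₁`, `N₂` (§1–§2), and the bigraded truncation of `X` is a degeneration of both.  No determinant or
  balancedness hypothesis is used.

Helper mode (`--supports stmt-ValiantsHypothesis-16133 --as helper`).  Honest framing: [folklore] linear algebra; the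
closer is part 3 (`…StubJordanHolder.lean`); nothing here bears on `OrbitDimensionBound`, `FreeSubtorus` or VP ≠ VNP
(all OPEN).
-/

set_option linter.dupNamespace false

namespace Summit.ValiantsHypothesis.ValiantsHypothesis.Theorems.FreeSubtorusOrbitDimensionBound.JordanHolder

open Matrix MvPolynomial

variable {m : ℕ}

/-! ### §1 Block-lower-triangular matrices for a pair of weights and their weight-diagonal parts -/

section Semiring

variable {R : Type*} [NonUnitalNonAssocSemiring R]

/-- A product of block-lower-triangular matrices (weights `(a, b)` and `(b, c)`) is block-lower-triangular for
`(a, c)`. [folklore] -/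
theorem lowerTri_mul (a b c : Fin m → ℕ) (X Y : Matrix (Fin m) (Fin m) R)
    (hX : ∀ i j, a i < b j → X i j = 0) (hY : ∀ i j, b i < c j → Y i j = 0) :
    ∀ i j, a i < c j → (X * Y) i j = 0 := by
  intro i j hij
  rw [Matrix.mul_apply]
  refine Finset.sum_eq_zero fun k _ => ?_
  by_cases hk : a i < b k
  · rw [hX i k hk, zero_mul]
  · rw [hY k j (lt_of_le_of_lt (not_lt.mp hk) hij), mul_zero]

/-- **Truncation is multiplicative along filtered products**: for `X` block-lower-triangular for `(a, b)` and `Y` for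
`(b, c)`, the `(a, c)`-weight-diagonal part of `X * Y` is the product of the weight-diagonal parts (the associated
graded of a composite of filtered maps). [folklore] -/
theorem truncate_mul (a b c : Fin m → ℕ) (X Y : Matrix (Fin m) (Fin m) R)
    (hX : ∀ i j, a i < b j → X i j = 0) (hY : ∀ i j, b i < c j → Y i j = 0) :
    (Matrix.of fun i j => if a i = c j then (X * Y) i j else 0) =
      (Matrix.of fun i j => if a i = b j then X i j else 0) * (Matrix.of fun i j => if b i = c j then Y i j else 0) := by
  ext i j
  simp only [Matrix.of_apply, Matrix.mul_apply]
  by_cases hac : a i = c j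
  · rw [if_pos hac]
    refine Finset.sum_congr rfl fun k _ => ?_
    by_cases hab : a i = b k
    · rw [if_pos hab, if_pos (hab ▸ hac)]
    · rcases lt_or_gt_of_ne hab with hlt | hgt
      · rw [hX i k hlt, zero_mul, if_neg hab, zero_mul]
      · rw [hY k j (hac ▸ hgt), mul_zero]
        split_ifs <;> simp
  · rw [if_neg hac]
    symm
    refine Finset.sum_eq_zero fun k _ => ?_
    by_cases hab : a i = b k
    · have hbc : ¬ b k = c j := fun h => hac (hab.trans h)
      rw [if_neg hbc, mul_zero]
    · rw [if_neg hab, zero_mul]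

/-- The entries of a weight-diagonal part are entries of the matrix or zero; in particular block-lower-triangularity
for any other pair of weights is inherited. [folklore] -/
theorem lowerTri_truncate (a b c d : Fin m → ℕ) (X : Matrix (Fin m) (Fin m) R)
    (hX : ∀ i j, c i < d j → X i j = 0) :
    ∀ i j, c i < d j → (Matrix.of fun i j => if a i = b j then X i j else 0) i j = 0 := by
  intro i j hij
  simp [hX i j hij]

/-- Two truncations commute (both keep exactly the entries with `a i = b j` and `c i = d j`). [folklore] -/
theorem truncate_truncate_comm (a b c d : Fin m → ℕ) (X : Matrix (Fin m) (Fin m) R) :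
    (Matrix.of fun i j => if c i = d j then (Matrix.of fun i j => if a i = b j then X i j else 0) i j else 0) =
      Matrix.of fun i j => if a i = b j then (Matrix.of fun i j => if c i = d j then X i j else 0) i j else 0 := by
  ext i j
  simp only [Matrix.of_apply]
  split_ifs <;> rfl

/-- Truncation commutes with an entrywise map fixing `0`. [folklore] -/
theorem truncate_map {S : Type*} [Zero S] (f : R → S) (hf : f 0 = 0) (a b : Fin m → ℕ) (X : Matrix (Fin m) (Fin m) R) :
    (Matrix.of fun i j => if a i = b j then X i j else 0).map f =
      Matrix.of fun i j => if a i = b j then X.map f i j else 0 := by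
  ext i j
  simp only [Matrix.map_apply, Matrix.of_apply]
  split_ifs <;> simp [hf]

/-- Block-lower-triangularity is preserved by an entrywise map fixing `0`. [folklore] -/
theorem lowerTri_map {S : Type*} [Zero S] (f : R → S) (hf : f 0 = 0) (a b : Fin m → ℕ) (X : Matrix (Fin m) (Fin m) R)
    (hX : ∀ i j, a i < b j → X i j = 0) : ∀ i j, a i < b j → X.map f i j = 0 := by
  intro i j hij
  simp [hX i j hij, hf]

end Semiring

/-! ### §2 The weight-diagonal part of a filtered invertible matrix is invertible -/

section Field

variable {K : Type*} [Field K]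

/-- The `(a, a)`-weight-diagonal part of the identity is the identity. [folklore] -/
theorem truncate_one (a : Fin m → ℕ) :
    (Matrix.of fun i j => if a i = a j then (1 : Matrix (Fin m) (Fin m) K) i j else 0) = 1 := by
  ext i j
  simp only [Matrix.of_apply, Matrix.one_apply]
  by_cases h : i = j
  · subst h; simp
  · simp [h]

/-- **The associated graded of a filtered isomorphism is an isomorphism.**  If `T` maps the `a`-flag into the
`α`-flag (`T` block-lower-triangular for `(α, a)`) and `T⁻¹` maps back (`T⁻¹` block-lower-triangular for `(a, α)`),
then the weight-diagonal parts of `T` and `T⁻¹` are mutually inverse. [folklore] -/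
theorem exists_GL_truncate (T : GL (Fin m) K) (α a : Fin m → ℕ)
    (hT : ∀ i j, α i < a j → (T : Matrix (Fin m) (Fin m) K) i j = 0)
    (hT' : ∀ i j, a i < α j → ((T⁻¹ : GL (Fin m) K) : Matrix (Fin m) (Fin m) K) i j = 0) :
    ∃ Td : GL (Fin m) K,
      (Td : Matrix (Fin m) (Fin m) K) = (Matrix.of fun i j => if α i = a j then (T : Matrix (Fin m) (Fin m) K) i j else 0) ∧
      ((Td⁻¹ : GL (Fin m) K) : Matrix (Fin m) (Fin m) K) =
        (Matrix.of fun i j => if a i = α j then ((T⁻¹ : GL (Fin m) K) : Matrix (Fin m) (Fin m) K) i j else 0) := by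
  have h1 : (Matrix.of fun i j => if α i = a j then (T : Matrix (Fin m) (Fin m) K) i j else 0) *
      (Matrix.of fun i j => if a i = α j then ((T⁻¹ : GL (Fin m) K) : Matrix (Fin m) (Fin m) K) i j else 0) = 1 := by
    rw [← truncate_mul α a α _ _ hT hT', ← Units.val_mul, mul_inv_cancel, Units.val_one, truncate_one]
  have h2 : (Matrix.of fun i j => if a i = α j then ((T⁻¹ : GL (Fin m) K) : Matrix (Fin m) (Fin m) K) i j else 0) *
      (Matrix.of fun i j => if α i = a j then (T : Matrix (Fin m) (Fin m) K) i j else 0) = 1 := by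
    rw [← truncate_mul a α a _ _ hT' hT, ← Units.val_mul, inv_mul_cancel, Units.val_one, truncate_one]
  exact ⟨⟨_, _, h1, h2⟩, rfl, rfl⟩

end Field

/-! ### §3 Level counts determine the total weight (layer cake) -/

/-- Layer cake: `Σ a = Σ_{k = 1}^{N} #{i | k ≤ a i}` for `N ≥ max a`. [folklore] -/
theorem sum_eq_sum_card_filter (c : Fin m → ℕ) (N : ℕ) (hN : ∀ i, c i ≤ N) :
    ∑ i, c i = ∑ k ∈ Finset.Icc 1 N, (Finset.univ.filter fun i => k ≤ c i).card := by
  simp_rw [Finset.card_filter]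
  rw [Finset.sum_comm]
  refine Finset.sum_congr rfl fun i _ => ?_
  rw [Finset.sum_boole]
  have : (Finset.Icc 1 N).filter (fun k => k ≤ c i) = Finset.Icc 1 (c i) := by
    ext k; simp only [Finset.mem_filter, Finset.mem_Icc]; constructor
    · rintro ⟨⟨h1, -⟩, h2⟩; exact ⟨h1, h2⟩
    · rintro ⟨h1, h2⟩; exact ⟨⟨h1, h2.trans (hN i)⟩, h2⟩
  simp [this, Nat.card_Icc]

/-- **Equal level counts give equal total weight.** [folklore] -/
theorem sum_eq_of_card_filter_eq (a b : Fin m → ℕ)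
    (h : ∀ k, (Finset.univ.filter fun i => k ≤ a i).card = (Finset.univ.filter fun i => k ≤ b i).card) :
    ∑ i, a i = ∑ i, b i := by
  obtain ⟨N, hNa, hNb⟩ : ∃ N, (∀ i, a i ≤ N) ∧ ∀ j, b j ≤ N :=
    ⟨(Finset.univ.sup a) ⊔ (Finset.univ.sup b),
      fun i => le_sup_of_le_left (Finset.le_sup (Finset.mem_univ i)),
      fun j => le_sup_of_le_right (Finset.le_sup (Finset.mem_univ j))⟩
  rw [sum_eq_sum_card_filter a N hNa, sum_eq_sum_card_filter b N hNb]
  exact Finset.sum_congr rfl fun k _ => h k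

/-! ### §4 Local confluence of one-parameter degenerations -/

section Confluence

variable {K : Type*} [Field K] {σ : Type*}

/-- Constant gauge is multiplicative: `(R·g)·M·(h·S) = R·(g·M·h)·S` with all constant factors mapped by `C`. [folklore] -/
theorem gauge_assoc (R g h S : Matrix (Fin m) (Fin m) K) (M : Matrix (Fin m) (Fin m) (MvPolynomial σ K)) :
    (R * g).map C * M * (h * S).map C = R.map C * (g.map C * M * h.map C) * S.map C := by
  rw [Matrix.map_mul, Matrix.map_mul]
  simp only [Matrix.mul_assoc]

/-- **Local confluence of one-parameter degenerations (modulo nothing).**  Two one-parameter degenerations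
`N₁ = trunc_{a₁,b₁}(g₁ M h₁)` and `N₂ = trunc_{a₂,b₂}(g₂ M h₂)` of the same square matrix of polynomials `M` have a
COMMON one-parameter degeneration `E`: a common adapted basis for the two row flags and one for the two column flags
(`exists_common_gauge`) give a gauge form `X = P⋆ M Q⋆` block-lower-triangular for both transported weight pairs;
its bigraded truncation `E` is a degeneration of both truncations (multiplicativity of truncation along filtered
gauge, `truncate_mul`; invertibility of the weight-diagonal parts, `exists_GL_truncate`).  No determinant or
balancedness hypothesis is needed. [folklore] -/
theorem exists_common_degeneration (M N₁ N₂ : Matrix (Fin m) (Fin m) (MvPolynomial σ K))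
    (g₁ h₁ : GL (Fin m) K) (a₁ b₁ : Fin m → ℕ) (hs₁ : ∑ i, a₁ i = ∑ j, b₁ j)
    (hz₁ : ∀ i j, a₁ i < b₁ j →
      ((g₁ : Matrix (Fin m) (Fin m) K).map C * M * (h₁ : Matrix (Fin m) (Fin m) K).map C : Matrix (Fin m) (Fin m) (MvPolynomial σ K)) i j = 0)
    (hN₁ : N₁ = Matrix.of fun i j => if a₁ i = b₁ j then
      ((g₁ : Matrix (Fin m) (Fin m) K).map C * M * (h₁ : Matrix (Fin m) (Fin m) K).map C : Matrix (Fin m) (Fin m) (MvPolynomial σ K)) i j else 0)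
    (g₂ h₂ : GL (Fin m) K) (a₂ b₂ : Fin m → ℕ) (hs₂ : ∑ i, a₂ i = ∑ j, b₂ j)
    (hz₂ : ∀ i j, a₂ i < b₂ j →
      ((g₂ : Matrix (Fin m) (Fin m) K).map C * M * (h₂ : Matrix (Fin m) (Fin m) K).map C : Matrix (Fin m) (Fin m) (MvPolynomial σ K)) i j = 0)
    (hN₂ : N₂ = Matrix.of fun i j => if a₂ i = b₂ j then
      ((g₂ : Matrix (Fin m) (Fin m) K).map C * M * (h₂ : Matrix (Fin m) (Fin m) K).map C : Matrix (Fin m) (Fin m) (MvPolynomial σ K)) i j else 0) :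
    ∃ E : Matrix (Fin m) (Fin m) (MvPolynomial σ K),
      (∃ (g h : GL (Fin m) K) (a b : Fin m → ℕ),
        (∀ i, (a i : ℕ∞) ≤ ⊤) ∧ (∀ j, (b j : ℕ∞) ≤ ⊤) ∧ ∑ i, a i = ∑ j, b j ∧
        (∀ i j, a i < b j →
          ((g : Matrix (Fin m) (Fin m) K).map C * N₁ * (h : Matrix (Fin m) (Fin m) K).map C : Matrix (Fin m) (Fin m) (MvPolynomial σ K)) i j = 0) ∧
        E = Matrix.of fun i j => if a i = b j then
          ((g : Matrix (Fin m) (Fin m) K).map C * N₁ * (h : Matrix (Fin m) (Fin m) K).map C : Matrix (Fin m) (Fin m) (MvPolynomial σ K)) i j else 0) ∧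
      (∃ (g h : GL (Fin m) K) (a b : Fin m → ℕ),
        (∀ i, (a i : ℕ∞) ≤ ⊤) ∧ (∀ j, (b j : ℕ∞) ≤ ⊤) ∧ ∑ i, a i = ∑ j, b j ∧
        (∀ i j, a i < b j →
          ((g : Matrix (Fin m) (Fin m) K).map C * N₂ * (h : Matrix (Fin m) (Fin m) K).map C : Matrix (Fin m) (Fin m) (MvPolynomial σ K)) i j = 0) ∧
        E = Matrix.of fun i j => if a i = b j then
          ((g : Matrix (Fin m) (Fin m) K).map C * N₂ * (h : Matrix (Fin m) (Fin m) K).map C : Matrix (Fin m) (Fin m) (MvPolynomial σ K)) i j else 0) := by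
  -- common adapted bases: columns (`T`, weights `β₁ β₂`) and rows (`T'`, weights `α₁ α₂`)
  obtain ⟨T, β₁, β₂, ⟨hS₁, hS₁', hcβ₁⟩, ⟨hS₂, hS₂', hcβ₂⟩⟩ := exists_common_gauge h₁ h₂ b₁ b₂
  obtain ⟨T', α₁, α₂, ⟨hR₁', hR₁, hcα₁⟩, ⟨hR₂', hR₂, hcα₂⟩⟩ := exists_common_gauge g₁⁻¹ g₂⁻¹ a₁ a₂
  simp only [inv_inv] at hR₁' hR₂'
  -- the filtered gauges `R_k = T'⁻¹ g_k⁻¹` (rows) and `S_k = h_k⁻¹ T` (columns) and their weight-diagonal parts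
  obtain ⟨Rd₁, hRd₁, -⟩ := exists_GL_truncate (T'⁻¹ * g₁⁻¹) α₁ a₁ hR₁
    (by rw [_root_.mul_inv_rev, inv_inv]; exact hR₁')
  obtain ⟨Rd₂, hRd₂, -⟩ := exists_GL_truncate (T'⁻¹ * g₂⁻¹) α₂ a₂ hR₂
    (by rw [_root_.mul_inv_rev, inv_inv]; exact hR₂')
  obtain ⟨Sd₁, hSd₁, -⟩ := exists_GL_truncate (h₁⁻¹ * T) b₁ β₁ hS₁
    (by rw [_root_.mul_inv_rev, inv_inv]; exact hS₁')
  obtain ⟨Sd₂, hSd₂, -⟩ := exists_GL_truncate (h₂⁻¹ * T) b₂ β₂ hS₂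
    (by rw [_root_.mul_inv_rev, inv_inv]; exact hS₂')
  -- the doubly adapted gauge form
  set X : Matrix (Fin m) (Fin m) (MvPolynomial σ K) :=
    ((T'⁻¹ : GL (Fin m) K) : Matrix (Fin m) (Fin m) K).map C * M * (T : Matrix (Fin m) (Fin m) K).map C with hXdef
  have hX : ∀ (g h : GL (Fin m) K),
      (((T'⁻¹ * g⁻¹ : GL (Fin m) K)) : Matrix (Fin m) (Fin m) K).map C *
        ((g : Matrix (Fin m) (Fin m) K).map C * M * (h : Matrix (Fin m) (Fin m) K).map C) *
        (((h⁻¹ * T : GL (Fin m) K)) : Matrix (Fin m) (Fin m) K).map C = X := by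
    intro g h
    rw [← gauge_assoc, ← Units.val_mul, ← Units.val_mul, inv_mul_cancel_right, mul_inv_cancel_left]
  -- `X` is block-lower-triangular for both weight pairs
  have hXz₁ : ∀ i j, α₁ i < β₁ j → X i j = 0 := by
    rw [← hX g₁ h₁]
    exact lowerTri_mul α₁ b₁ β₁ _ _ (lowerTri_mul α₁ a₁ b₁ _ _ (lowerTri_map C C_0 α₁ a₁ _ hR₁) hz₁)
      (lowerTri_map C C_0 b₁ β₁ _ hS₁)
  have hXz₂ : ∀ i j, α₂ i < β₂ j → X i j = 0 := by
    rw [← hX g₂ h₂]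
    exact lowerTri_mul α₂ b₂ β₂ _ _ (lowerTri_mul α₂ a₂ b₂ _ _ (lowerTri_map C C_0 α₂ a₂ _ hR₂) hz₂)
      (lowerTri_map C C_0 b₂ β₂ _ hS₂)
  -- the transported truncations are gauge forms of `N₁`, `N₂`
  have hN₁' : (Rd₁ : Matrix (Fin m) (Fin m) K).map C * N₁ * (Sd₁ : Matrix (Fin m) (Fin m) K).map C =
      Matrix.of fun i j => if α₁ i = β₁ j then X i j else 0 := by
    rw [hRd₁, hSd₁, hN₁, truncate_map C C_0, truncate_map C C_0, ← hX g₁ h₁,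
      truncate_mul α₁ b₁ β₁ _ _ (lowerTri_mul α₁ a₁ b₁ _ _ (lowerTri_map C C_0 α₁ a₁ _ hR₁) hz₁)
        (lowerTri_map C C_0 b₁ β₁ _ hS₁),
      truncate_mul α₁ a₁ b₁ _ _ (lowerTri_map C C_0 α₁ a₁ _ hR₁) hz₁]
  have hN₂' : (Rd₂ : Matrix (Fin m) (Fin m) K).map C * N₂ * (Sd₂ : Matrix (Fin m) (Fin m) K).map C =
      Matrix.of fun i j => if α₂ i = β₂ j then X i j else 0 := by
    rw [hRd₂, hSd₂, hN₂, truncate_map C C_0, truncate_map C C_0, ← hX g₂ h₂,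
      truncate_mul α₂ b₂ β₂ _ _ (lowerTri_mul α₂ a₂ b₂ _ _ (lowerTri_map C C_0 α₂ a₂ _ hR₂) hz₂)
        (lowerTri_map C C_0 b₂ β₂ _ hS₂),
      truncate_mul α₂ a₂ b₂ _ _ (lowerTri_map C C_0 α₂ a₂ _ hR₂) hz₂]
  -- total weights
  have hsα₁ : ∑ i, α₁ i = ∑ j, β₁ j := by
    rw [sum_eq_of_card_filter_eq α₁ a₁ hcα₁, hs₁, ← sum_eq_of_card_filter_eq β₁ b₁ hcβ₁]
  have hsα₂ : ∑ i, α₂ i = ∑ j, β₂ j := by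
    rw [sum_eq_of_card_filter_eq α₂ a₂ hcα₂, hs₂, ← sum_eq_of_card_filter_eq β₂ b₂ hcβ₂]
  -- the bigraded truncation
  refine ⟨Matrix.of fun i j => if α₂ i = β₂ j then (Matrix.of fun i j => if α₁ i = β₁ j then X i j else 0) i j else 0,
    ⟨Rd₁, Sd₁, α₂, β₂, fun _ => le_top, fun _ => le_top, hsα₂, ?_, ?_⟩,
    ⟨Rd₂, Sd₂, α₁, β₁, fun _ => le_top, fun _ => le_top, hsα₁, ?_, ?_⟩⟩
  · rw [hN₁']; exact lowerTri_truncate α₁ β₁ α₂ β₂ X hXz₂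
  · rw [hN₁']
  · rw [hN₂']; exact lowerTri_truncate α₂ β₂ α₁ β₁ X hXz₁
  · rw [hN₂', truncate_truncate_comm]

end Confluence

end Summit.ValiantsHypothesis.ValiantsHypothesis.Theorems.FreeSubtorusOrbitDimensionBound.JordanHolder
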